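import Literature.AlgebraicGeometry.Resolution.AffineModelLU
import HarnessLib

/-!
# Transport of local models: sandwiched subrings, field embeddings, localized bases

Topic: `Literature/AlgebraicGeometry/Resolution`. Plumbing for local uniformization statements
whose conclusion is "a finitely generated model `T = S[t] ⊆ 𝒪_v` is regular at the centre
`𝔪_v ∩ T`" (Cossart–Piltant's (LU), `CPLocalUniformization`; the local theorem
`CossartPiltant2019Local`, whose base is a regular LOCAL ring `S`; `ArithmeticalThreefolds*.lean`).
When such statements are chained (Cossart–Piltant 2019, proof of Prop. 4.10 = arXiv v1
Prop. 4.8: the local theorem is applied again over the local ring `T_P` of the previous model,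
inside a finite extension of the fraction field), three transports are needed, all PROVED here:

* `isLocalization_atPrime_under_of_sandwich`, `isRegularLocalRing_localization_iff_of_sandwich`,
  `isRegularLocalRing_localization_comap_iff_of_sandwich` — **sandwich, abstract form**: for an
  injective `A' → T` into a domain with `A' ⊆ T ⊆ A'_{P ∩ A'}` (every `t` is `a'/s'`, `s' ∉ P`),
  `T_P` is the localization of `A'` at `P ∩ A'` (no common fraction field is needed, unlike
  `isRegularLocalRing_localization_of_sandwich` of `AffineModelLU.lean`);
* `isRegularLocalRing_localization_map_iff` — **field embeddings**: an `S`-embedding `f : L → E`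
  identifies the local ring of `R ⊆ L` at the centre of `O_E ∘ f` with that of `f(R)` at the
  centre of `O_E`;
* `exists_mul_mem_adjoin_of_mem_adjoin_localization`, `mem_adjoin_localization_of_mem_adjoin_union`,
  `isRegularLocalRing_localization_adjoin_union_iff` — **localized base**: for an `S`-subalgebra
  `T ⊆ L` of a field, a prime `P = {v < 1}` of `T` and `u ⊆ L`, the model `T_P[u]` over the
  local base `T_P` (realised in `L` as an abstract localization `Sₚ`) and the model `S[T ∪ u]`
  over `S` have isomorphic local rings at the centre of `v`:
  `S[T ∪ u] ⊆ T_P[u] ⊆ S[T ∪ u]_{𝔪_v ∩ S[T ∪ u]}`.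

Everything is PROVED; no named facts are introduced. (Implementation note: equalities between
elements of the two subalgebras `S[T ∪ u]` and `T_P[u]` are read off in `L` through
`Subalgebra.val`; a bare `rfl` between their coercions makes the kernel compare the two
membership predicates and time out.)

## Sources

* V. Cossart, O. Piltant, J. Algebra 529 (2019) 268–535 = arXiv:1412.0868, proof of Prop. 4.10
  (arXiv v1: Prop. 4.8, pp. 53–54). [CossartPiltant2019]
-/

noncomputable section

open IsLocalRing

namespace Literature.AlgebraicGeometry.Resolution

universe u

/-! ## Sandwiched subrings have the same localization -/

section Sandwich

variable {A' T : Type u} [CommRing A'] [CommRing T] [IsDomain T] [Algebra A' T]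

/-- **Sandwich, abstract form.** Let `A' → T` be an injective homomorphism into a domain and `P`
a prime of `T` such that every `t ∈ T` becomes `a'/s'` with `a', s' ∈ A'`, `s' ∉ P` — i.e.
`A' ⊆ T ⊆ A'_{P ∩ A'}`. Then `T_P` is the localization of `A'` at `P ∩ A'`. (No fraction field
is needed; cf. `isRegularLocalRing_localization_of_sandwich`, the version inside a common
fraction field.) [folklore] -/
theorem isLocalization_atPrime_under_of_sandwich (hinj : Function.Injective (algebraMap A' T))
    (P : Ideal T) [P.IsPrime]
    (H : ∀ t : T, ∃ a s : A', algebraMap A' T s ∉ P ∧ t * algebraMap A' T s = algebraMap A' T a) :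
    IsLocalization.AtPrime (Localization.AtPrime P) (P.under A') := by
  set φ := algebraMap T (Localization.AtPrime P) with hφ
  have hsc : ∀ a : A', algebraMap A' (Localization.AtPrime P) a = φ (algebraMap A' T a) :=
    fun a => IsScalarTower.algebraMap_apply A' T (Localization.AtPrime P) a
  rw [IsLocalization.AtPrime, isLocalization_iff]
  refine ⟨?_, ?_, ?_⟩
  · rintro ⟨y, hy⟩
    have hyP : algebraMap A' T y ∉ P := fun h => hy (Ideal.mem_comap.mpr h)
    rw [hsc]
    exact IsLocalization.map_units (Localization.AtPrime P) (⟨algebraMap A' T y, hyP⟩ : P.primeCompl)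
  · intro z
    obtain ⟨⟨t, u⟩, hz⟩ := IsLocalization.surj P.primeCompl z
    obtain ⟨a, s, hs, hts⟩ := H t
    obtain ⟨b, r, hr, hur⟩ := H u
    have hb : algebraMap A' T b ∉ P := by
      rw [← hur]
      exact P.primeCompl.mul_mem u.2 hr
    have hbs : b * s ∉ P.under A' := fun h => by
      rw [Ideal.under_def, Ideal.mem_comap, map_mul] at h
      exact (P.primeCompl.mul_mem hb hs) h
    refine ⟨⟨a * r, ⟨b * s, hbs⟩⟩, ?_⟩
    change z * algebraMap A' _ (b * s) = algebraMap A' _ (a * r)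
    rw [hsc, hsc]
    simp only [map_mul]
    rw [← hur, ← hts]
    simp only [map_mul]
    change z * φ u = φ t at hz
    linear_combination (φ (algebraMap A' T r) * φ (algebraMap A' T s)) * hz
  · intro x y hxy
    refine ⟨1, ?_⟩
    rw [hsc, hsc] at hxy
    have h1 : algebraMap A' T x = algebraMap A' T y :=
      IsLocalization.injective (Localization.AtPrime P) P.primeCompl_le_nonZeroDivisors hxy
    rw [hinj h1]

/-- Hence, in the sandwich situation, `A'_{P ∩ A'} ≅ T_P`, and one is a regular local ring iff
the other is. [folklore] -/
theorem isRegularLocalRing_localization_iff_of_sandwich (hinj : Function.Injective (algebraMap A' T))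
    (P : Ideal T) [P.IsPrime]
    (H : ∀ t : T, ∃ a s : A', algebraMap A' T s ∉ P ∧ t * algebraMap A' T s = algebraMap A' T a) :
    IsRegularLocalRing (Localization.AtPrime (P.under A')) ↔
      IsRegularLocalRing (Localization.AtPrime P) := by
  haveI := isLocalization_atPrime_under_of_sandwich hinj P H
  let e : Localization.AtPrime (P.under A') ≃ₐ[A'] Localization.AtPrime P :=
    IsLocalization.algEquiv (P.under A').primeCompl _ _
  exact ⟨fun _ => IsRegularLocalRing.of_ringEquiv e.toRingEquiv,
    fun _ => IsRegularLocalRing.of_ringEquiv e.toRingEquiv.symm⟩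

/-- Ring-homomorphism form of `isRegularLocalRing_localization_iff_of_sandwich` (no `Algebra`
instance between `A'` and `T` is needed in the statement). [folklore] -/
theorem isRegularLocalRing_localization_comap_iff_of_sandwich {A' T : Type u} [CommRing A']
    [CommRing T] [IsDomain T] (f : A' →+* T) (hinj : Function.Injective f) (P : Ideal T)
    [P.IsPrime] (H : ∀ t : T, ∃ a s : A', f s ∉ P ∧ t * f s = f a) :
    IsRegularLocalRing (Localization.AtPrime (P.comap f)) ↔
      IsRegularLocalRing (Localization.AtPrime P) := by
  letI : Algebra A' T := f.toAlgebra
  exact isRegularLocalRing_localization_iff_of_sandwich (A' := A') (T := T) hinj P H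

end Sandwich

/-! ## Field embeddings -/

section Embedding

variable {S L E : Type u} [CommRing S] [Field L] [Field E] [Algebra S L] [Algebra S E]

/-- **Local models are transported along field embeddings.** For an `S`-embedding of fields
`f : L → E`, a valuation ring `O_E` of `E`, an `S`-subalgebra `R ⊆ L` and the primes `P ⊆ R`,
`Q ⊆ f(R)` cut out by `v_E ∘ f < 1` and `v_E < 1` (the centres of `O_E ∩ L` on `R` and of `O_E`
on `f(R)`), `R_P ≅ f(R)_Q`; in particular one is regular iff the other is. [folklore] -/
theorem isRegularLocalRing_localization_map_iff (f : L →ₐ[S] E) (OE : ValuationSubring E)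
    (R : Subalgebra S L) (P : Ideal R) [P.IsPrime] (hP : ∀ x : R, x ∈ P ↔ OE.valuation (f x) < 1)
    (Q : Ideal (R.map f)) [Q.IsPrime] (hQ : ∀ y : R.map f, y ∈ Q ↔ OE.valuation (y : E) < 1) :
    IsRegularLocalRing (Localization.AtPrime P) ↔ IsRegularLocalRing (Localization.AtPrime Q) := by
  have hf : Function.Injective f := f.toRingHom.injective
  let g : R ≃ₐ[S] R.map f := R.equivMapOfInjective f hf
  have hg : ∀ x : R, ((g x : R.map f) : E) = f x := fun _ => rfl
  have hPQ : P = Q.comap g.toRingEquiv.toRingHom := by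
    ext x
    rw [hP, Ideal.mem_comap, hQ]
    change OE.valuation (f x) < 1 ↔ OE.valuation ((g x : R.map f) : E) < 1
    rw [hg]
  have hmap : Submonoid.map g.toRingEquiv.toMonoidHom P.primeCompl = Q.primeCompl := by
    ext y
    constructor
    · rintro ⟨x, hx, rfl⟩
      simpa [Ideal.primeCompl, hPQ] using hx
    · intro hy
      refine ⟨g.symm y, ?_, by simp⟩
      simpa [Ideal.primeCompl, hPQ] using hy
  let e : Localization.AtPrime P ≃+* Localization.AtPrime Q :=
    IsLocalization.ringEquivOfRingEquiv (Localization.AtPrime P) (Localization.AtPrime Q)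
      g.toRingEquiv hmap
  exact ⟨fun _ => IsRegularLocalRing.of_ringEquiv e, fun _ => IsRegularLocalRing.of_ringEquiv e.symm⟩

end Embedding

/-! ## Models over a localized base -/

section LocalizedBase

variable {S L : Type u} [CommRing S] [Field L] [Algebra S L] (O : ValuationSubring L)
  (T : Subalgebra S L) (P : Ideal T) [P.IsPrime]
  (Sₚ : Type u) [CommRing Sₚ] [Algebra T Sₚ] [IsLocalization.AtPrime Sₚ P] [Algebra Sₚ L]
  [IsScalarTower T Sₚ L] [Algebra S Sₚ] [IsScalarTower S Sₚ L]

omit [Algebra S Sₚ] [IsScalarTower S Sₚ L] in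
/-- **Elements of `T_P[u]` are fractions `a/s`, `a ∈ S[T ∪ u]`, `s ∈ T ∖ P`** (`T ⊆ L` an
`S`-subalgebra of a field, `T_P` its localization at a prime, realised in `L`, `u ⊆ L`).
[folklore] -/
theorem exists_mul_mem_adjoin_of_mem_adjoin_localization (u : Set L) (z : L)
    (hz : z ∈ Algebra.adjoin Sₚ u) :
    ∃ a s : L, a ∈ Algebra.adjoin S ((T : Set L) ∪ u) ∧ s ∈ T ∧
      (∀ hs : s ∈ T, (⟨s, hs⟩ : T) ∉ P) ∧ z * s = a := by
  have hTle : (T : Set L) ⊆ Algebra.adjoin S ((T : Set L) ∪ u) := fun x hx =>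
    Algebra.subset_adjoin (Set.mem_union_left _ hx)
  have hule : u ⊆ Algebra.adjoin S ((T : Set L) ∪ u) := fun x hx =>
    Algebra.subset_adjoin (Set.mem_union_right _ hx)
  refine Algebra.adjoin_induction (p := fun z _ => ∃ a s : L, a ∈ Algebra.adjoin S ((T : Set L) ∪ u) ∧
      s ∈ T ∧ (∀ hs : s ∈ T, (⟨s, hs⟩ : T) ∉ P) ∧ z * s = a) ?_ ?_ ?_ ?_ hz
  · intro x hx
    exact ⟨x, 1, hule hx, one_mem _, fun _ h => Ideal.IsPrime.ne_top' ((Ideal.eq_top_iff_one _).mpr h),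
      mul_one _⟩
  · intro c
    obtain ⟨⟨a, s⟩, rfl⟩ := IsLocalization.mk'_surjective P.primeCompl c
    refine ⟨(a : L), (s : T), hTle a.2, (s : T).2, fun _ => s.2, ?_⟩
    have h := IsLocalization.mk'_spec Sₚ a s
    have h' := congrArg (algebraMap Sₚ L) h
    rw [map_mul, ← IsScalarTower.algebraMap_apply, ← IsScalarTower.algebraMap_apply] at h'
    exact h'
  · rintro x y - - ⟨a₁, s₁, ha₁, hs₁, hp₁, h₁⟩ ⟨a₂, s₂, ha₂, hs₂, hp₂, h₂⟩
    refine ⟨a₁ * s₂ + a₂ * s₁, s₁ * s₂, add_mem (mul_mem ha₁ (hTle hs₂)) (mul_mem ha₂ (hTle hs₁)),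
      mul_mem hs₁ hs₂, fun hs h => ?_, ?_⟩
    · rcases Ideal.IsPrime.mem_or_mem ‹P.IsPrime›
        (show (⟨s₁, hs₁⟩ : T) * ⟨s₂, hs₂⟩ ∈ P from h) with h | h
      · exact hp₁ hs₁ h
      · exact hp₂ hs₂ h
    · rw [← h₁, ← h₂]; ring
  · rintro x y - - ⟨a₁, s₁, ha₁, hs₁, hp₁, h₁⟩ ⟨a₂, s₂, ha₂, hs₂, hp₂, h₂⟩
    refine ⟨a₁ * a₂, s₁ * s₂, mul_mem ha₁ ha₂, mul_mem hs₁ hs₂, fun hs h => ?_, ?_⟩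
    · rcases Ideal.IsPrime.mem_or_mem ‹P.IsPrime›
        (show (⟨s₁, hs₁⟩ : T) * ⟨s₂, hs₂⟩ ∈ P from h) with h | h
      · exact hp₁ hs₁ h
      · exact hp₂ hs₂ h
    · rw [← h₁, ← h₂]; ring

/-- `S[T ∪ u] ⊆ T_P[u]` (elementwise, across the two scalar rings). [folklore] -/
theorem mem_adjoin_localization_of_mem_adjoin_union (u : Set L) {x : L}
    (hx : x ∈ Algebra.adjoin S ((T : Set L) ∪ u)) : x ∈ Algebra.adjoin Sₚ u := by
  refine Algebra.adjoin_induction (p := fun x _ => x ∈ Algebra.adjoin Sₚ u) ?_ ?_ ?_ ?_ hx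
  · rintro x (hx | hx)
    · have hmem : algebraMap Sₚ L (algebraMap T Sₚ ⟨x, hx⟩) ∈ Algebra.adjoin Sₚ u :=
        Subalgebra.algebraMap_mem _ _
      have heq : algebraMap Sₚ L (algebraMap T Sₚ ⟨x, hx⟩) = x :=
        (IsScalarTower.algebraMap_apply T Sₚ L _).symm
      rw [heq] at hmem
      exact hmem
    · exact Algebra.subset_adjoin hx
  · intro c
    rw [IsScalarTower.algebraMap_apply S Sₚ L]
    exact Subalgebra.algebraMap_mem _ _
  · exact fun _ _ _ _ hx hy => add_mem hx hy
  · exact fun _ _ _ _ hx hy => mul_mem hx hy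

/-- **Localized base.** Let `T ⊆ L` be an `S`-subalgebra of a field with a prime `P` cut out by a
valuation ring `O` of `L` (`P = {v < 1}`), `T_P` its localization realised in `L`, and `u ⊆ L`.
Then the model `T_P[u]` over the local base `T_P` and the model `S[T ∪ u]` over `S` have the same
local ring at the centre of `O`: `S[T ∪ u] ⊆ T_P[u] ⊆ S[T ∪ u]_{𝔪_O ∩ S[T ∪ u]}` (denominators
from `T ∖ P` are `v`-units). This is how a local-uniformization statement over the regular local
ring `T_P` (e.g. Cossart–Piltant's local theorem, `CossartPiltant2019Local`) is turned back into
a finitely generated model over the original base `S`. [folklore] -/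
theorem isRegularLocalRing_localization_adjoin_union_iff (hP : ∀ x : T, x ∈ P ↔ O.valuation (x : L) < 1)
    (u : Set L) (P' : Ideal (Algebra.adjoin S ((T : Set L) ∪ u))) [P'.IsPrime]
    (hP' : ∀ x : Algebra.adjoin S ((T : Set L) ∪ u), x ∈ P' ↔ O.valuation (x : L) < 1)
    (Q : Ideal (Algebra.adjoin Sₚ u)) [Q.IsPrime]
    (hQ : ∀ y : Algebra.adjoin Sₚ u, y ∈ Q ↔ O.valuation (y : L) < 1) :
    IsRegularLocalRing (Localization.AtPrime P') ↔ IsRegularLocalRing (Localization.AtPrime Q) := by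
  have hle : ∀ x : Algebra.adjoin S ((T : Set L) ∪ u), (x : L) ∈ Algebra.adjoin Sₚ u := fun x =>
    mem_adjoin_localization_of_mem_adjoin_union T Sₚ u x.2
  -- the inclusion `S[T ∪ u] → T_P[u]`
  let ι : Algebra.adjoin S ((T : Set L) ∪ u) →+* Algebra.adjoin Sₚ u :=
    ((Algebra.adjoin S ((T : Set L) ∪ u)).val : _ →+* L).codRestrict (Algebra.adjoin Sₚ u) hle
  -- (values of `ι` are read off in `L` through `Subalgebra.val`, which keeps the kernel away from
  -- comparing the membership predicates of the two subalgebras)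
  have hι : ∀ x : Algebra.adjoin S ((T : Set L) ∪ u),
      ((ι x : Algebra.adjoin Sₚ u) : L) = (Algebra.adjoin S ((T : Set L) ∪ u)).val x :=
    fun _ => rfl
  have hinj : Function.Injective ι := by
    intro x y h
    have h' : (Algebra.adjoin S ((T : Set L) ∪ u)).val x =
        (Algebra.adjoin S ((T : Set L) ∪ u)).val y := by
      rw [← hι x, ← hι y, h]
    exact Subtype.ext h'
  have H : ∀ t : Algebra.adjoin Sₚ u, ∃ a s : Algebra.adjoin S ((T : Set L) ∪ u),
      ι s ∉ Q ∧ t * ι s = ι a := by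
    intro t
    obtain ⟨a, s, ha, hs, hsP, hts⟩ :=
      exists_mul_mem_adjoin_of_mem_adjoin_localization T P Sₚ u t t.2
    have hsA : s ∈ Algebra.adjoin S ((T : Set L) ∪ u) :=
      Algebra.subset_adjoin (Set.mem_union_left _ hs)
    refine ⟨⟨a, ha⟩, ⟨s, hsA⟩, ?_, Subtype.ext hts⟩
    rw [hQ, hι]
    have := hsP hs
    rw [hP] at this
    exact this
  -- `P' = ι⁻¹ Q`, so the localizations agree
  have hpc : P'.primeCompl = (Q.comap ι).primeCompl := by
    ext x
    simp only [Ideal.primeCompl, Submonoid.mem_mk, Subsemigroup.mem_mk, Set.mem_compl_iff,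
      SetLike.mem_coe]
    rw [hP', Ideal.mem_comap, hQ, hι]
    rfl
  let e : Localization.AtPrime P' ≃+* Localization.AtPrime (Q.comap ι) :=
    IsLocalization.ringEquivOfRingEquiv (M := P'.primeCompl) (T := (Q.comap ι).primeCompl)
      (Localization.AtPrime P') (Localization.AtPrime (Q.comap ι)) (RingEquiv.refl _)
      (by rw [hpc]; exact Submonoid.map_id _)
  rw [← isRegularLocalRing_localization_comap_iff_of_sandwich ι hinj Q H]
  exact ⟨fun _ => IsRegularLocalRing.of_ringEquiv e, fun _ => IsRegularLocalRing.of_ringEquiv e.symm⟩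

end LocalizedBase

end Literature.AlgebraicGeometry.Resolution
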